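import Literature.Probability.RandomPlanarGeometry.SAWAllTurnUnfoldConcat
import Literature.Probability.RandomPlanarGeometry.SAWBendingEnergyAllTurnWindow
import HarnessLib

/-!
# `b^{AT}(2m) ≤ μ_AT^{2m}` and the all-turn Hammersley–Welsh upper bound («L-POLY-RATE» S7, S8)

Topic `Literature/Probability/RandomPlanarGeometry` (continues `SAWAllTurnUnfoldConcat.lean` — `allTurnBridges`,
`allTurnBridgeCount`, S6 `allTurnConcat` — and `SAWBendingEnergyAllTurnWindow.lean` — Fekete
`tendsto_log_allTurnCount_div : log a(N)/N → log μ_AT`).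

Statements (a-idea-2 gen 9, `Sketch_v9R_LPOLYRate.lean` 9cc7a3a3107b4a84, «L-POLY-RATE» supports, bodies verbatim
with `muAT := exp (logMuAT)` written out):
* S7 `AllTurnBridgeLeMu` — for every `m`, `b^{AT}(2m) ≤ μ_AT^{2m}` (Madras–Slade (1.2.17) inside the all-turn
  class: by S6, `b^{AT}(2m)^k ≤ b^{AT}(2mk) ≤ a(2mk)`, so `log b^{AT}(2m) ≤ 2m · log a(2mk)/(2mk) → 2m · log μ_AT`);
* S8 from S1 and S4 (`HWUpperAssembly` with S5/S6/S7 discharged): `allTurnHWUpper_of (hS1) (hS4) :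
  ∃ c, a(N) ≤ e^{c√N} μ_AT^N` — the all-turn Hammersley–Welsh UPPER bound (Madras–Slade (3.1.13): for odd `N`,
  `a(N) = 2a_V(N) ≤ 2 Σ_{m odd} h^{AT}(m+1) h^{AT}(N−m) ≤ 2(N+1) e^{6√(N+1)} b^{AT}(N+1) ≤ … μ_AT^{N+1}`; even `N`
  by `a(N) ≤ 4 a(N−1)`); S1 `AllTurnSwap` and S4 `AllTurnHWSplit` are a-p3's items and enter as hypotheses.
[cite: MadrasSlade1993, §1.2, eq. (1.2.17); Theorem 3.1.1, (3.1.13)]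
-/

noncomputable section

open Finset Filter Topology
open scoped BigOperators
open Literature.Probability.LatticeModels Literature.Probability.Percolation

namespace Literature.Probability.RandomPlanarGeometry.SAW.Zd

open Literature.Probability.RandomPlanarGeometry.SAW

/-- An all-turn bridge is an all-turn walk: `b^{AT}(N) ≤ a(N)`. [cite: MadrasSlade1993, §1.2] -/
theorem allTurnBridgeCount_le_allTurnCount (N : ℕ) : allTurnBridgeCount N ≤ allTurnCount N := by
  classical
  unfold allTurnBridgeCount allTurnBridges allTurnCount
  exact Finset.card_le_card (Finset.filter_subset_filter _ fun ω hω => (mem_bridges.1 hω).1)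

/-- Iterated even concatenation: `b^{AT}(2m)^k ≤ b^{AT}(2mk)`. [cite: MadrasSlade1993, §1.2, eq. (1.2.15)] -/
theorem allTurnBridgeCount_pow_le (m : ℕ) : ∀ k : ℕ, allTurnBridgeCount (2 * m) ^ k ≤ allTurnBridgeCount (2 * m * k)
  | 0 => by
    -- `b^{AT}(0) ≥ 1`: the trivial bridge
    rw [pow_zero, mul_zero]
    classical
    unfold allTurnBridgeCount allTurnBridges
    refine Finset.card_pos.2 ⟨straightWalk 2 0, Finset.mem_filter.2
      ⟨mem_bridges.2 ⟨straightWalk_mem_saws 2 0, fun i h1 h2 => by omega⟩, ?_⟩⟩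
    rw [turns_eq_sub_one_iff]
    intro j hj; omega
  | k + 1 => by
    have ih := allTurnBridgeCount_pow_le m k
    calc allTurnBridgeCount (2 * m) ^ (k + 1) = allTurnBridgeCount (2 * m) * allTurnBridgeCount (2 * m) ^ k := by ring
      _ ≤ allTurnBridgeCount (2 * m) * allTurnBridgeCount (2 * m * k) := Nat.mul_le_mul_left _ ih
      _ ≤ allTurnBridgeCount (2 * m + 2 * m * k) := allTurnConcat m (2 * m * k)
      _ = allTurnBridgeCount (2 * m * (k + 1)) := by ring_nf

/-- **S7 `AllTurnBridgeLeMu`** (a-idea-2's `V9R.AllTurnBridgeLeMu`, body verbatim with `muAT = exp logMuAT`):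
`b^{AT}(2m) ≤ μ_AT^{2m}` for every `m`. [cite: MadrasSlade1993, §1.2, eq. (1.2.17)] -/
theorem allTurnBridgeLeMu : ∀ m : ℕ, (allTurnBridgeCount (2 * m) : ℝ) ≤ Real.exp logMuAT ^ (2 * m) := by
  intro m
  rcases Nat.eq_zero_or_pos (allTurnBridgeCount (2 * m)) with h0 | hpos
  · rw [h0]; simp only [Nat.cast_zero]; positivity
  rcases Nat.eq_zero_or_pos m with rfl | hm
  · -- `b^{AT}(0) ≤ 1`: a `0`-step walk from the origin is constant
    have h : allTurnBridgeCount 0 ≤ 1 := by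
      classical
      unfold allTurnBridgeCount allTurnBridges
      refine (Finset.card_filter_le _ _).trans (Finset.card_le_one.2 fun a ha b hb => ?_)
      have ha' := mem_saws.1 (mem_bridges.1 ha).1
      have hb' := mem_saws.1 (mem_bridges.1 hb).1
      funext i
      rw [ha'.2.1 i (Nat.zero_le i), hb'.2.1 i (Nat.zero_le i), ha'.1, hb'.1]
    have : (allTurnBridgeCount (2 * 0) : ℝ) ≤ 1 := by rw [mul_zero]; exact_mod_cast h
    simpa using this
  -- `log b ≤ 2m · (log a(2mk))/(2mk)` for every `k ≥ 1`, and the right side tends to `2m · log μ_AT`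
  set b : ℝ := (allTurnBridgeCount (2 * m) : ℝ) with hb
  have hb0 : 0 < b := by rw [hb]; exact_mod_cast hpos
  have hkey : ∀ k : ℕ, 1 ≤ k →
      Real.log b ≤ 2 * m * (Real.log (allTurnCount (2 * m * k)) / ((2 * m * k : ℕ) : ℝ)) := by
    intro k hk
    have h1 : b ^ k ≤ (allTurnCount (2 * m * k) : ℝ) := by
      rw [hb]
      exact_mod_cast (allTurnBridgeCount_pow_le m k).trans (allTurnBridgeCount_le_allTurnCount _)
    have h2 : (k : ℝ) * Real.log b ≤ Real.log (allTurnCount (2 * m * k)) := by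
      rw [← Real.log_pow]
      exact Real.log_le_log (pow_pos hb0 k) h1
    have hmk : (0 : ℝ) < ((2 * m * k : ℕ) : ℝ) := by exact_mod_cast (by positivity : 0 < 2 * m * k)
    rw [mul_div_assoc', le_div_iff₀ hmk]
    push_cast
    have hk0 : (0 : ℝ) < k := by exact_mod_cast hk
    nlinarith
  -- pass to the limit along `k ↦ 2mk`
  have hlim : Tendsto (fun k : ℕ => 2 * m * (Real.log (allTurnCount (2 * m * k)) / ((2 * m * k : ℕ) : ℝ)))
      atTop (𝓝 (2 * m * logMuAT)) := by
    have hsub : Tendsto (fun k : ℕ => 2 * m * k) atTop atTop :=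
      (tendsto_id.const_mul_atTop' (by positivity : 0 < 2 * m)).congr fun k => by simp [id]
    exact (tendsto_log_allTurnCount_div.comp hsub).const_mul _
  have hle : Real.log b ≤ 2 * m * logMuAT :=
    ge_of_tendsto hlim (eventually_atTop.2 ⟨1, fun k hk => hkey k hk⟩)
  calc b = Real.exp (Real.log b) := (Real.exp_log hb0).symm
    _ ≤ Real.exp (2 * m * logMuAT) := Real.exp_le_exp.2 hle
    _ = Real.exp logMuAT ^ (2 * m) := by rw [← Real.exp_nat_mul]; push_cast; ring_nf

/-! ### S8 glue: the all-turn Hammersley–Welsh UPPER bound from S1 and S4 -/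

/-- `a(1) ≤ 4` and `a(N+1) ≤ 4 a(N)`. [cite: MadrasSlade1993, §1.2] -/
theorem allTurnCount_succ_le (N : ℕ) : allTurnCount (N + 1) ≤ 4 * allTurnCount N := by
  have h1 : allTurnCount 1 ≤ 4 := by
    rw [allTurnCount_eq_card_allTurnWords]; exact (card_allTurnWords_le_pow 1).trans (by norm_num)
  calc allTurnCount (N + 1) ≤ allTurnCount N * allTurnCount 1 := allTurnSubmult N 1
    _ ≤ allTurnCount N * 4 := Nat.mul_le_mul_left _ h1
    _ = 4 * allTurnCount N := by ring

/-- `1 ≤ μ_AT = exp (log μ_AT)` and `μ_AT ≤ 2`. [cite: MadrasSlade1993, §1.2] -/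
theorem one_le_exp_logMuAT : (1 : ℝ) ≤ Real.exp logMuAT ∧ Real.exp logMuAT ≤ 2 := by
  constructor
  · refine Real.one_le_exp ?_
    refine le_trans ?_ log_sqrt_two_le_logMuAT
    exact Real.log_nonneg (Real.one_le_sqrt.2 (by norm_num))
  · have h := logMuAT_le_log_goldenRatio
    have hφ : (1 + Real.sqrt 5) / 2 ≤ 2 := by
      have : Real.sqrt 5 ≤ 3 := by
        rw [show (3 : ℝ) = Real.sqrt (3 ^ 2) by rw [Real.sqrt_sq (by norm_num)]]
        exact Real.sqrt_le_sqrt (by norm_num)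
      linarith
    calc Real.exp logMuAT ≤ Real.exp (Real.log ((1 + Real.sqrt 5) / 2)) := Real.exp_le_exp.2 h
      _ = (1 + Real.sqrt 5) / 2 := Real.exp_log (by positivity)
      _ ≤ 2 := hφ

/-- `x + 1 ≤ e^{2√(x+1)}`-type bound: `(N : ℝ) + 1 ≤ exp (2 * √(N+1))`. [folklore] -/
private theorem natCast_succ_le_exp_sqrt (N : ℕ) : (N : ℝ) + 1 ≤ Real.exp (2 * Real.sqrt ((N : ℝ) + 1)) := by
  have h := Real.add_one_le_exp (Real.sqrt ((N : ℝ) + 1))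
  have hs : 0 ≤ Real.sqrt ((N : ℝ) + 1) := Real.sqrt_nonneg _
  have hsq : Real.sqrt ((N : ℝ) + 1) ^ 2 = (N : ℝ) + 1 := Real.sq_sqrt (by positivity)
  calc (N : ℝ) + 1 = Real.sqrt ((N : ℝ) + 1) ^ 2 := hsq.symm
    _ ≤ Real.exp (Real.sqrt ((N : ℝ) + 1)) ^ 2 := by
        exact pow_le_pow_left₀ hs (by linarith) 2
    _ = Real.exp (2 * Real.sqrt ((N : ℝ) + 1)) := by rw [← Real.exp_nat_mul]; norm_num

/-- `√(N+1) ≤ 2 √N` for `N ≥ 1`. [folklore] -/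
private theorem sqrt_succ_le_two_sqrt {N : ℕ} (hN : 1 ≤ N) : Real.sqrt ((N : ℝ) + 1) ≤ 2 * Real.sqrt N := by
  have hN' : (1 : ℝ) ≤ N := by exact_mod_cast hN
  rw [show (2 : ℝ) * Real.sqrt N = Real.sqrt (2 ^ 2 * N) by
    rw [Real.sqrt_mul (by norm_num), Real.sqrt_sq (by norm_num)]]
  exact Real.sqrt_le_sqrt (by nlinarith)

/-- **Odd lengths**: `a(N) ≤ 2 (N+1) e^{6√(N+1)} μ_AT^{N+1}` for odd `N`, from S1 (`a = 2 a_V`), S4 (split at the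
last lowest vertex), S5 (unfolding), S6 (even concatenation) and S7 (`b^{AT}(2m) ≤ μ_AT^{2m}`).
[cite: MadrasSlade1993, Theorem 3.1.1, (3.1.7)–(3.1.13)] -/
theorem allTurnCount_le_of_odd
    (hS1 : ∀ N : ℕ, 1 ≤ N → 2 * allTurnCountV N = allTurnCount N)
    (hS4 : ∀ N : ℕ, Odd N → allTurnCountV N ≤
      ∑ m ∈ (Finset.range (N + 1)).filter Odd, allTurnHalfSpaceCount (m + 1) * allTurnHalfSpaceCount (N - m))
    {N : ℕ} (hN : Odd N) :
    (allTurnCount N : ℝ) ≤ 2 * ((N : ℝ) + 1) * Real.exp (6 * Real.sqrt ((N : ℝ) + 1)) *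
      Real.exp logMuAT ^ (N + 1) := by
  set μ := Real.exp logMuAT with hμ
  have hμ0 : 0 < μ := Real.exp_pos _
  have hN1 : 1 ≤ N := hN.pos
  -- each term of the S4 sum is `≤ e^{6√(N+1)} μ^{N+1}`
  have hterm : ∀ m ∈ (Finset.range (N + 1)).filter Odd,
      ((allTurnHalfSpaceCount (m + 1) * allTurnHalfSpaceCount (N - m) : ℕ) : ℝ) ≤
        Real.exp (6 * Real.sqrt ((N : ℝ) + 1)) * μ ^ (N + 1) := by
    intro m hm
    rw [Finset.mem_filter, Finset.mem_range] at hm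
    obtain ⟨hmN, hmodd⟩ := hm
    obtain ⟨j, hj⟩ : ∃ j, m + 1 = 2 * j := ⟨(m + 1) / 2, by obtain ⟨i, rfl⟩ := hmodd; omega⟩
    have h5a := allTurnUnfold (m + 1)
    have h5b := allTurnUnfold (N - m)
    have h6 : (allTurnBridgeCount (m + 1) * allTurnBridgeCount (N - m) : ℕ) ≤ allTurnBridgeCount (N + 1) := by
      rw [hj, show N + 1 = 2 * j + (N - m) by omega]; exact allTurnConcat j (N - m)
    have h7 : (allTurnBridgeCount (N + 1) : ℝ) ≤ μ ^ (N + 1) := by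
      obtain ⟨i, hi⟩ : ∃ i, N + 1 = 2 * i := ⟨(N + 1) / 2, by obtain ⟨t, rfl⟩ := hN; omega⟩
      rw [hi]; exact allTurnBridgeLeMu i
    have hsq1 : Real.sqrt ((m + 1 : ℕ) : ℝ) ≤ Real.sqrt ((N : ℝ) + 1) :=
      Real.sqrt_le_sqrt (by exact_mod_cast (show m + 1 ≤ N + 1 by omega))
    have hsq2 : Real.sqrt ((N - m : ℕ) : ℝ) ≤ Real.sqrt ((N : ℝ) + 1) :=
      Real.sqrt_le_sqrt (by
        have : ((N - m : ℕ) : ℝ) ≤ N := by exact_mod_cast Nat.sub_le N m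
        linarith)
    have hb0 : ∀ n, (0 : ℝ) ≤ allTurnBridgeCount n := fun n => Nat.cast_nonneg _
    calc ((allTurnHalfSpaceCount (m + 1) * allTurnHalfSpaceCount (N - m) : ℕ) : ℝ)
        = (allTurnHalfSpaceCount (m + 1) : ℝ) * allTurnHalfSpaceCount (N - m) := by push_cast; ring
      _ ≤ (Real.exp (3 * Real.sqrt ((m + 1 : ℕ) : ℝ)) * allTurnBridgeCount (m + 1)) *
            (Real.exp (3 * Real.sqrt ((N - m : ℕ) : ℝ)) * allTurnBridgeCount (N - m)) :=
          mul_le_mul h5a h5b (Nat.cast_nonneg _) (by positivity)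
      _ ≤ (Real.exp (3 * Real.sqrt ((N : ℝ) + 1)) * allTurnBridgeCount (m + 1)) *
            (Real.exp (3 * Real.sqrt ((N : ℝ) + 1)) * allTurnBridgeCount (N - m)) := by
          gcongr
      _ = Real.exp (6 * Real.sqrt ((N : ℝ) + 1)) *
            ((allTurnBridgeCount (m + 1) : ℝ) * allTurnBridgeCount (N - m)) := by
          rw [show (6 : ℝ) * Real.sqrt ((N : ℝ) + 1) = 3 * Real.sqrt ((N : ℝ) + 1) + 3 * Real.sqrt ((N : ℝ) + 1)
            by ring, Real.exp_add]; ring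
      _ ≤ Real.exp (6 * Real.sqrt ((N : ℝ) + 1)) * (allTurnBridgeCount (N + 1) : ℝ) := by
          refine mul_le_mul_of_nonneg_left ?_ (Real.exp_pos _).le
          exact_mod_cast h6
      _ ≤ Real.exp (6 * Real.sqrt ((N : ℝ) + 1)) * μ ^ (N + 1) :=
          mul_le_mul_of_nonneg_left h7 (Real.exp_pos _).le
  have hcard : (((Finset.range (N + 1)).filter Odd).card : ℝ) ≤ (N : ℝ) + 1 := by
    have := ((Finset.range (N + 1)).filter Odd).card_filter_le (p := Odd)
    have h' : ((Finset.range (N + 1)).filter Odd).card ≤ N + 1 :=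
      (Finset.card_filter_le _ _).trans (by rw [Finset.card_range])
    exact_mod_cast h'
  have hsum := Finset.sum_le_sum hterm
  rw [Finset.sum_const, nsmul_eq_mul] at hsum
  have hS1N := hS1 N hN1
  have hS4N := hS4 N hN
  have hA : (allTurnCount N : ℝ) = 2 * (allTurnCountV N : ℝ) := by rw [← hS1N]; push_cast; ring
  rw [hA]
  have hV : (allTurnCountV N : ℝ) ≤ ((N : ℝ) + 1) * (Real.exp (6 * Real.sqrt ((N : ℝ) + 1)) * μ ^ (N + 1)) := by
    calc (allTurnCountV N : ℝ)
        ≤ ((∑ m ∈ (Finset.range (N + 1)).filter Odd,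
            allTurnHalfSpaceCount (m + 1) * allTurnHalfSpaceCount (N - m) : ℕ) : ℝ) := by exact_mod_cast hS4N
      _ = ∑ m ∈ (Finset.range (N + 1)).filter Odd,
            ((allTurnHalfSpaceCount (m + 1) * allTurnHalfSpaceCount (N - m) : ℕ) : ℝ) := by push_cast; rfl
      _ ≤ (((Finset.range (N + 1)).filter Odd).card : ℝ) * (Real.exp (6 * Real.sqrt ((N : ℝ) + 1)) * μ ^ (N + 1)) :=
          hsum
      _ ≤ ((N : ℝ) + 1) * (Real.exp (6 * Real.sqrt ((N : ℝ) + 1)) * μ ^ (N + 1)) :=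
          mul_le_mul_of_nonneg_right hcard (by positivity)
  nlinarith [hV, Real.exp_pos (6 * Real.sqrt ((N : ℝ) + 1)), pow_pos hμ0 (N + 1)]

/-- **S8 from S1 and S4** (a-idea-2's `HWUpperAssembly` with S5/S6/S7 discharged by this file and
`SAWAllTurnBridgeLeMu`): the all-turn Hammersley–Welsh UPPER bound `a(N) ≤ e^{20√N} μ_AT^N`.
[cite: MadrasSlade1993, Theorem 3.1.1, (3.1.13)] -/
theorem allTurnHWUpper_of
    (hS1 : ∀ N : ℕ, 1 ≤ N → 2 * allTurnCountV N = allTurnCount N)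
    (hS4 : ∀ N : ℕ, Odd N → allTurnCountV N ≤
      ∑ m ∈ (Finset.range (N + 1)).filter Odd, allTurnHalfSpaceCount (m + 1) * allTurnHalfSpaceCount (N - m)) :
    ∃ c : ℝ, ∀ N : ℕ, (allTurnCount N : ℝ) ≤ Real.exp (c * Real.sqrt N) * Real.exp logMuAT ^ N := by
  set μ := Real.exp logMuAT with hμ
  obtain ⟨hμ1, hμ2⟩ := one_le_exp_logMuAT
  have hμ0 : 0 < μ := Real.exp_pos _
  refine ⟨20, fun N => ?_⟩
  -- the odd-length bound, massaged: `a(M) ≤ e^{18√M} μ^M` for odd `M`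
  have hodd : ∀ M : ℕ, Odd M → (allTurnCount M : ℝ) ≤ Real.exp (18 * Real.sqrt M) * μ ^ M := by
    intro M hM
    have hM1 : 1 ≤ M := hM.pos
    have h := allTurnCount_le_of_odd hS1 hS4 hM
    have hs := sqrt_succ_le_two_sqrt hM1
    have hsN : 0 ≤ Real.sqrt (M : ℝ) := Real.sqrt_nonneg _
    have h1 : (M : ℝ) + 1 ≤ Real.exp (2 * Real.sqrt ((M : ℝ) + 1)) := natCast_succ_le_exp_sqrt M
    have h2 : Real.exp (2 * Real.sqrt ((M : ℝ) + 1)) ≤ Real.exp (4 * Real.sqrt M) := Real.exp_le_exp.2 (by linarith)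
    have h3 : Real.exp (6 * Real.sqrt ((M : ℝ) + 1)) ≤ Real.exp (12 * Real.sqrt M) := Real.exp_le_exp.2 (by linarith)
    have h4 : (2 : ℝ) * μ ≤ Real.exp (2 * Real.sqrt M) := by
      have h1le : (1 : ℝ) ≤ Real.sqrt M := by
        rw [show (1 : ℝ) = Real.sqrt 1 by simp]; exact Real.sqrt_le_sqrt (by exact_mod_cast hM1)
      have h5 : (4 : ℝ) ≤ Real.exp (2 * Real.sqrt M) := by
        have h6 : Real.exp 1 ≤ Real.exp (Real.sqrt M) := Real.exp_le_exp.2 h1le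
        have h7 : (2 : ℝ) ≤ Real.exp 1 := by
          have := Real.add_one_le_exp (1 : ℝ); linarith
        calc (4 : ℝ) = 2 * 2 := by norm_num
          _ ≤ Real.exp 1 * Real.exp 1 := mul_le_mul h7 h7 (by norm_num) (Real.exp_pos _).le
          _ ≤ Real.exp (Real.sqrt M) * Real.exp (Real.sqrt M) :=
              mul_le_mul h6 h6 (Real.exp_pos _).le (Real.exp_pos _).le
          _ = Real.exp (2 * Real.sqrt M) := by rw [← Real.exp_add]; ring_nf
      linarith
    calc (allTurnCount M : ℝ)
        ≤ 2 * ((M : ℝ) + 1) * Real.exp (6 * Real.sqrt ((M : ℝ) + 1)) * μ ^ (M + 1) := h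
      _ = (2 * μ) * ((M : ℝ) + 1) * Real.exp (6 * Real.sqrt ((M : ℝ) + 1)) * μ ^ M := by ring
      _ ≤ Real.exp (2 * Real.sqrt M) * Real.exp (4 * Real.sqrt M) * Real.exp (12 * Real.sqrt M) * μ ^ M := by
          have hA : (0 : ℝ) ≤ 2 * μ := by positivity
          have hB : (0 : ℝ) ≤ (M : ℝ) + 1 := by positivity
          gcongr
          · exact h1.trans h2
      _ = Real.exp (18 * Real.sqrt M) * μ ^ M := by
          rw [← Real.exp_add, ← Real.exp_add]; ring_nf
  have hmono : ∀ {a b : ℝ}, a ≤ b → Real.exp (a * Real.sqrt N) * μ ^ N ≤ Real.exp (b * Real.sqrt N) * μ ^ N :=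
    fun hab => mul_le_mul_of_nonneg_right (Real.exp_le_exp.2
      (mul_le_mul_of_nonneg_right hab (Real.sqrt_nonneg _))) (pow_nonneg hμ0.le _)
  rcases Nat.even_or_odd N with hev | hod
  · rcases Nat.eq_zero_or_pos N with rfl | hNpos
    · -- `a(0) = 1`
      have h0 : allTurnCount 0 ≤ 1 := by
        rw [allTurnCount_eq_card_allTurnWords]; exact (card_allTurnWords_le_pow 0).trans (by norm_num)
      have : (allTurnCount 0 : ℝ) ≤ 1 := by exact_mod_cast h0
      simpa using this
    · -- even `N = M + 1` with `M` odd: `a(N) ≤ 4 a(M)`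
      obtain ⟨M, rfl⟩ : ∃ M, N = M + 1 := ⟨N - 1, by omega⟩
      have hM : Odd M := by
        rcases Nat.even_or_odd M with h | h
        · exfalso; exact (Nat.even_add_one.1 hev) h
        · exact h
      have h1 := hodd M hM
      have hsM : Real.sqrt (M : ℝ) ≤ Real.sqrt ((M + 1 : ℕ) : ℝ) := Real.sqrt_le_sqrt (by push_cast; linarith)
      have h4' : (4 : ℝ) ≤ Real.exp (2 * Real.sqrt ((M + 1 : ℕ) : ℝ)) := by
        have h1le : (1 : ℝ) ≤ Real.sqrt ((M + 1 : ℕ) : ℝ) := by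
          rw [show (1 : ℝ) = Real.sqrt 1 by simp]
          exact Real.sqrt_le_sqrt (by push_cast; linarith [(Nat.cast_nonneg M : (0 : ℝ) ≤ M)])
        have h7 : (2 : ℝ) ≤ Real.exp 1 := by have := Real.add_one_le_exp (1 : ℝ); linarith
        have h6 : Real.exp 1 ≤ Real.exp (Real.sqrt ((M + 1 : ℕ) : ℝ)) := Real.exp_le_exp.2 h1le
        calc (4 : ℝ) = 2 * 2 := by norm_num
          _ ≤ Real.exp 1 * Real.exp 1 := mul_le_mul h7 h7 (by norm_num) (Real.exp_pos _).le
          _ ≤ Real.exp (Real.sqrt ((M + 1 : ℕ) : ℝ)) * Real.exp (Real.sqrt ((M + 1 : ℕ) : ℝ)) :=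
              mul_le_mul h6 h6 (Real.exp_pos _).le (Real.exp_pos _).le
          _ = Real.exp (2 * Real.sqrt ((M + 1 : ℕ) : ℝ)) := by rw [← Real.exp_add]; ring_nf
      calc (allTurnCount (M + 1) : ℝ) ≤ ((4 * allTurnCount M : ℕ) : ℝ) := by
            exact_mod_cast allTurnCount_succ_le M
        _ = 4 * (allTurnCount M : ℝ) := by push_cast; ring
        _ ≤ 4 * (Real.exp (18 * Real.sqrt M) * μ ^ M) := by linarith
        _ ≤ Real.exp (2 * Real.sqrt ((M + 1 : ℕ) : ℝ)) * (Real.exp (18 * Real.sqrt ((M + 1 : ℕ) : ℝ)) * μ ^ (M + 1)) := by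
            refine mul_le_mul h4' ?_ (by positivity) (Real.exp_pos _).le
            refine mul_le_mul (Real.exp_le_exp.2 (by linarith)) ?_ (by positivity) (Real.exp_pos _).le
            rw [pow_succ]
            exact le_mul_of_one_le_right (pow_nonneg hμ0.le _) hμ1
        _ = Real.exp (20 * Real.sqrt ((M + 1 : ℕ) : ℝ)) * μ ^ (M + 1) := by
            rw [← mul_assoc, ← Real.exp_add]; ring_nf
  · exact (hodd N hod).trans (hmono (by norm_num))

end Literature.Probability.RandomPlanarGeometry.SAW.Zd

end
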